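import Summits.PneNP.PneNP.Theorems.ChebyshevTracialDesignExtendedSign
import Summits.PneNP.PneNP.Theorems.ChebyshevTracialDesignPseudoMatchingBaseTransport
import HarnessLib

/-!
# Cell pnp-psdrank, route `ChebyshevTracialDesign`: the MATCHING-SIDE SIGN cell at all matching degrees `k' ≤ c'/2` (crux `TracialDecayExp20`,
# stmt-PneNP-19878) — twin of brick 90 (`…ExtendedSign.value_le_of_lowDegree_allModes`)

Brick 93 (prover g17; MEMO-20 §2(c)/§4). The tree's matching-side SIGN cell (`…PseudoMatchingBaseTransport.sum_levelWeight_trace_nonpos_of_lowDegreeM`,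
matching degree `k'` with `2k' ≤ D`) stops at the design degree only because the per-CUT exact level law (`…LowDegreeMatchingSide.lowdegM_sum_law`:
`Σ_{M : cc(U,M)=c} tr(X_U B_M B_Mᵀ) = R_c·P_U(c)`, `deg P_U ≤ 2k'`, `P_U(0) ≥ 0` by the Grigoriev ⊗ Grigoriev pseudo-matching form) is read through
exactness. As in brick 90: the averaged exact law `Φ(c) = |Q_c|·P♭(c)` is compared with brick 20's degree-`2k'` profile polynomial of the pair
`(X, BBᵀ)` at ALL odd levels and extrapolated to the virtual level (brick 89 §1), the gap between the cutoffs `D` and `2k'` is crossed by bricks 45b/45d,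
and brick 22a converts `−VV_D/|PM|` into the design value:
* §1 `value_le_of_lowDegreeM_allModes_of_forms` — modulo the per-cut clique forms of `…PseudoMatchingTensor.…_of_clique_forms`;
* §2 **`value_le_of_lowDegreeM_allModes`** — UNCONDITIONAL for `6k'+1 ≤ t`, `6k'+1 ≤ n − t` (forms discharged by `form_nonneg_of_base` /
  `base_nonneg_of_story_nonneg` / `story_nonneg_of_six_mul_le`): `Y = BBᵀ ⪯ I` of matching degree `≤ k'` (`D ≤ 2k' ≤ c'`) against ANY contraction
  cut side is priced at `r·(B_v√P_D + 2^{2k'+1}√P_{2k'} + Σ_{κ∈(D/2,k']} R_κ√A_κ)`, r-uniformly. With 90/90b, SIGN∞ is two-sided.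
[cite: Potechin2019, Thm. 1.2 and Cor. 3.10 (LIPIcs 124, 61:4, 61:9)] [cite: Grigoriev2001TCS, Cor. 2 (p. 622)] [cite: Rothvoss2017, §2 (PDF p. 6)]
[cite: GriblingDelaatLaurent2019, §5] [cite: BrouwerHaemers2012, Thm. 4.9.1 (PDF p. 93)]
Stature: support/instrument (kernel lane, no defs, axioms standard). WHAT THIS IS NOT: no proof or refutation of `TracialDecayExp20`, nothing on psd rank
of P_PM(K_n), no P-vs-NP content. Supports stmt-PneNP-19878.
-/
set_option linter.dupNamespace false -- `Summit.PneNP.PneNP.…`: summit = sub-problem (D-0017)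

noncomputable section

namespace Summit.PneNP.PneNP.Theorems.ChebyshevTracialDesignExtendedSignMatchingSide

open Finset Matrix Polynomial Literature.Barriers.PneNP Literature.Combinatorics.SimpleGraph.CycleSpace
open Literature.Computability.Complexity Literature.Combinatorics.Optimization
open Literature.Combinatorics.AssociationSchemes Literature.Combinatorics.AssociationSchemes.JohnsonHarmonics
open Literature.Combinatorics.AssociationSchemes.JohnsonSpectrum open ChebyshevTracialDesignJunta
open ChebyshevTracialDesignTracialProfilePolynomial open ChebyshevTracialDesignProfileExtrapolation (value_eq_level_sums)
open ChebyshevTracialDesignProfilePolynomial (card_pmatch_pos) open ChebyshevTracialDesignExtrapolatedSign (abs_eval_zero_le_two_pow_mul)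
open ChebyshevTracialDesignExtendedSign (sum_trace_cuts_le sum_trace_matchings_le) open ChebyshevTracialDesignVirtualBimodePsd (virtual_psd_mul_eq)
open ChebyshevTracialDesignHSModeParseval (HSmode_sq_le_traces) open ChebyshevTracialDesignVirtualValueUnique (tracial_value_truncation_of_data)
open ChebyshevTracialDesignWhiteningData (layerRatio_nonneg) open ChebyshevTracialDesignTightFreeSpectral (exists_tightGram_classFunction)
open ChebyshevTracialDesignAPrioriBounds (trace_le_of_sub_posSemidef) open ChebyshevTracialDesignMonomialVirtualValue
open ChebyshevTracialDesignDesignLevelPolyAssembly (sum_pmatch_level_eq') open ChebyshevTracialDesignLowDegreeMatchingSide (lowdegM_sum_law)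
open ChebyshevTracialDesignPseudoMatchingTensor (virtualForm_nonneg_of_clique_forms)
open ChebyshevTracialDesignPseudoMatchingFormRecursion (form_nonneg_of_base cutCount_eq_two_iff cutCount_eq_zero_iff)
open ChebyshevTracialDesignPseudoMatchingBaseTransport (base_nonneg_of_story_nonneg story_nonneg_of_six_mul_le) open scoped MatrixOrder

variable {n : ℕ}

/-! ### §1 Matching-side Gram factors of any degree `≤ c'/2`, modulo the per-cut clique forms -/

set_option maxHeartbeats 400000 in
/-- **MATCHING-SIDE SIGN AT ALL DEGREES, modulo the per-cut clique forms** (hypotheses `hU`, `hUc` as in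
`…PseudoMatchingTensor.sum_levelWeight_trace_nonpos_of_lowDegreeM_of_clique_forms`). [cite: Potechin2019, Thm. 1.2 (LIPIcs 124, 61:4)]
[cite: Rothvoss2017, §2 (PDF p. 6)] [cite: GriblingDelaatLaurent2019, §5] -/
theorem value_le_of_lowDegreeM_allModes_of_forms {c' T D : ℕ} {Bv : ℝ} {C : Finset ℕ} {w : ℕ → ℝ} (hn : Even n)
    (hdes : IsExactDesign n (2 * c' + 1) T D Bv C w) (hD : D ≤ 2 * c') {r m k : ℕ} (hDk : D ≤ 2 * k) (hkc : 2 * k ≤ c')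
    (X : OddSet n → Matrix (Fin r) (Fin r) ℝ) (hX : ∀ U, (X U).PosSemidef ∧ (1 - X U).PosSemidef)
    (B : PMatch n → Matrix (Fin r) (Fin m) ℝ) (hB : IsLowDegreeM n k B) (hB1 : ∀ M, (1 - B M * (B M)ᵀ).PosSemidef)
    (hU : ∀ U : OddSet n, U.1.card = 2 * c' + 1 → ∀ δ : {F : Finset (Sym2 (Fin n)) // F.card ≤ k} → ℝ,
      0 ≤ ∑ A, ∑ A', δ A * δ A' *
        (if ((univ : Finset (PMatch n)).filter fun M => A.1 ∪ A'.1 ⊆ M.1).Nonempty ∧ (∀ e ∈ A.1 ∪ A'.1, cutCount U.1 e = 2) then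
          (∏ j ∈ range (A.1 ∪ A'.1).card, (((2 * c' + 1 : ℕ) : ℝ) - 1 - 2 * j))⁻¹ else 0))
    (hUc : ∀ U : OddSet n, U.1.card = 2 * c' + 1 → ∀ δ : {F : Finset (Sym2 (Fin n)) // F.card ≤ k} → ℝ,
      0 ≤ ∑ A, ∑ A', δ A * δ A' *
        (if ((univ : Finset (PMatch n)).filter fun M => A.1 ∪ A'.1 ⊆ M.1).Nonempty ∧ (∀ e ∈ A.1 ∪ A'.1, cutCount U.1 e = 0) then
          (∏ j ∈ range (A.1 ∪ A'.1).card, (((n - (2 * c' + 1) : ℕ) : ℝ) - 1 - 2 * j))⁻¹ else 0)) :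
    ∑ U, ∑ M, levelWeight n (2 * c' + 1) C w U M * (X U * (B M * (B M)ᵀ)).trace ≤
      (r : ℝ) * (Bv * Real.sqrt (∏ i ∈ range (D / 2 + 1), ((2 * i + 1 : ℝ) / ((n : ℝ) - 2 * i))) +
        2 ^ (2 * k + 1) * Real.sqrt (∏ i ∈ range (k + 1), ((2 * i + 1 : ℝ) / ((n : ℝ) - 2 * i))) +
        ∑ κ ∈ Ico (D / 2 + 1) (k + 1),
          (∏ i ∈ range κ, (((2 * c' + 1 : ℝ) - 2 * i) * ((n : ℝ) - 2 * c' - 1 - 2 * i) /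
              (((2 * c' : ℝ) - 2 * i) * ((n : ℝ) - 2 * c' - 2 - 2 * i)))) *
            Real.sqrt (∏ i ∈ range κ, ((2 * i + 1 : ℝ) / ((n : ℝ) - 2 * i)))) := by
  classical
  have hdes' := hdes
  obtain ⟨htodd, htn, hTt, hC, -, hexact, hBv⟩ := hdes
  have ht : 2 * (2 * c' + 1) ≤ n := by omega
  have hPm : (0 : ℝ) < Fintype.card (PMatch n) := by exact_mod_cast card_pmatch_pos hn
  have hCn : (0 : ℝ) < (n.choose (2 * c' + 1) : ℝ) := by exact_mod_cast Nat.choose_pos (by omega)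
  set Pm : ℝ := (Fintype.card (PMatch n) : ℝ) with hPmdef
  set Cn : ℝ := (n.choose (2 * c' + 1) : ℝ) with hCndef
  set N₁ : ℝ := ((((n / 2).choose (1 + c') * (1 + c').choose c' * 2 ^ 1 : ℕ) : ℝ)) with hN₁
  have hN₁pos : 0 < N₁ := by
    rw [hN₁]
    exact_mod_cast Nat.mul_pos (Nat.mul_pos (Nat.choose_pos (by omega)) (Nat.choose_pos (by omega))) (by norm_num)
  set Aκ : ℕ → ℝ := fun κ => ∏ i ∈ range κ, ((2 * i + 1 : ℝ) / ((n : ℝ) - 2 * i)) with hAκ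
  set R : ℕ → ℝ := fun κ => ∏ i ∈ range κ, (((2 * c' + 1 : ℝ) - 2 * i) * ((n : ℝ) - 2 * c' - 1 - 2 * i) /
    (((2 * c' : ℝ) - 2 * i) * ((n : ℝ) - 2 * c' - 2 - 2 * i))) with hR
  have hAκ0 : ∀ κ, κ ≤ c' → 0 ≤ Aκ κ := fun κ hκ => by
    rw [hAκ]; refine prod_nonneg fun i hi => ?_
    have : (2 * i : ℝ) + 2 ≤ n := by have := mem_range.1 hi; exact_mod_cast (show 2 * i + 2 ≤ n by omega)
    exact div_nonneg (by positivity) (by linarith)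
  set Y : PMatch n → Matrix (Fin r) (Fin r) ℝ := fun M => B M * (B M)ᵀ with hYdef
  have hYpsd : ∀ M : PMatch n, (B M * (B M)ᵀ).PosSemidef := fun M => by
    simpa [Matrix.conjTranspose_eq_transpose_of_trivial] using Matrix.posSemidef_self_mul_conjTranspose (B M)
  have hY : ∀ M : PMatch n, (Y M).PosSemidef ∧ (1 - Y M).PosSemidef := fun M => ⟨hYpsd M, hB1 M⟩
  have hβ' : ∀ a j, ∃ c : {F : Finset (Sym2 (Fin n)) // F.card ≤ k} → ℝ,
      ∑ F, c F • (fun M : PMatch n => if F.1 ⊆ M.1 then (1 : ℝ) else 0) = fun M => B M a j :=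
    fun a j => (Submodule.mem_span_range_iff_exists_fun ℝ).1 (hB a j)
  choose β hβ using hβ'
  have hBeval : ∀ M : PMatch n, B M = Matrix.of fun a j =>
      ∑ F : {F : Finset (Sym2 (Fin n)) // F.card ≤ k}, β a j F * (if F.1 ⊆ M.1 then (1 : ℝ) else 0) := fun M => by
    ext a j
    have := congrFun (hβ a j) M
    rw [Finset.sum_apply] at this
    rw [Matrix.of_apply, ← this]
    exact sum_congr rfl fun F _ => by rw [Pi.smul_apply, smul_eq_mul]
  have hS' : ∀ U : OddSet n, ∃ S : Matrix (Fin r) (Fin r) ℝ, ∀ a b, X U b a = ∑ l, S l a * S l b :=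
    fun U => exists_gram_of_posSemidef (hX U).1
  choose S hS using hS'
  set μ : OddSet n → Finset (Sym2 (Fin n)) → ℝ := fun U G =>
    if ((univ : Finset (PMatch n)).filter fun M => G ⊆ M.1).Nonempty then
      (if (G.filter fun e => cutCount U.1 e = 1).card = 0 then
        (∏ j ∈ range (G.filter fun e => cutCount U.1 e = 2).card, ((U.1.card : ℝ) - 1 - 2 * j))⁻¹ *
        (∏ j ∈ range (G.card - (G.filter fun e => cutCount U.1 e = 1).card - (G.filter fun e => cutCount U.1 e = 2).card),
          (((n - U.1.card : ℕ) : ℝ) - 1 - 2 * j))⁻¹ else 0)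
    else 0 with hμdef
  have hP : ∀ U : OddSet n, ∃ P : Polynomial ℝ, P.natDegree ≤ 2 * k ∧ 0 ≤ P.eval 0 ∧ (U.1.card ≠ 2 * c' + 1 → P = 0) ∧
      (U.1.card = 2 * c' + 1 → ∀ c i i' : ℕ, c + 2 * i = 2 * c' + 1 → c + 2 * i' = n - (2 * c' + 1) →
        ∑ M : PMatch n, (if U.1.card = 2 * c' + 1 ∧ cc U M = c then (X U * Y M).trace else 0) =
          ((((perfectMatchings (univ : Finset (Fin n))).filter fun M' =>
              (M'.filter fun e => cutCount U.1 e = 1).card = c).card : ℕ) : ℝ) * P.eval (c : ℝ)) := fun U => by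
    by_cases hUt : U.1.card = 2 * c' + 1
    · obtain ⟨P, hPdeg, hP0, hPval⟩ := lowdegM_sum_law U hUt (X U) (S U) (hS U) β (μ U)
        (fun G => by simp only [hμdef, hUt])
      refine ⟨P, hPdeg, ?_, fun h => absurd hUt h, fun _ c i i' hci hci' => ?_⟩
      · rw [hP0]
        refine sum_nonneg fun j _ => sum_nonneg fun l _ => ?_
        have h := virtualForm_nonneg_of_clique_forms hn U (hU U hUt) (hUc U hUt) (fun F => ∑ a, S U l a * β a j F)
        refine le_of_le_of_eq h (sum_congr rfl fun F _ => sum_congr rfl fun F' _ => ?_)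
        simp only [hμdef, hUt]
      · rw [← hPval c i i' hci hci']
        refine Fintype.sum_congr _ _ fun M => ?_
        rw [hYdef]
        dsimp only
        rw [hBeval M]
    · exact ⟨0, by simp, by simp, fun _ => rfl, fun h => absurd h hUt⟩
  choose P hPdeg hP0 hPzero hPval using hP
  have hcardc : ∀ U : OddSet n, ((univ : Finset (Fin n)) \ U.1).card = n - U.1.card := fun U => by
    rw [card_sdiff_of_subset (subset_univ _), card_univ, Fintype.card_fin]
  have htot : ∀ (U : OddSet n), U.1.card = 2 * c' + 1 → ∀ c i i' : ℕ, c + 2 * i = 2 * c' + 1 → c + 2 * i' = n - (2 * c' + 1) →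
      ((((perfectMatchings (univ : Finset (Fin n))).filter fun M' =>
          (M'.filter fun e => cutCount U.1 e = 1).card = c).card : ℕ) : ℝ) *
        ((c.factorial * (2 ^ i * i.factorial) * (2 ^ i' * i'.factorial) : ℕ) : ℝ) =
        (((2 * c' + 1).factorial * (n - (2 * c' + 1)).factorial : ℕ) : ℝ) := fun U hUt c i i' hci hci' => by
    have key := card_pm_filter_cr_mul (subset_univ U.1) (a := c) (i := i) (i' := i')
      (by rw [hUt, hci]) (by rw [hcardc U, hUt, hci'])
    rw [hci, hci'] at key
    exact_mod_cast key
  set Nt : ℝ := ∑ U : OddSet n, (if U.1.card = 2 * c' + 1 then (1 : ℝ) else 0) with hNt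
  have hNt_eq : Nt = Cn := by
    rw [hNt, hCndef, sum_oddSet_card_eq (odd_two_mul_add_one c') (fun _ => (1 : ℝ)), sum_const, card_powersetCard, card_univ,
      Fintype.card_fin, nsmul_eq_mul, mul_one]
  have hQ : ∀ c i i' : ℕ, c + 2 * i = 2 * c' + 1 → c + 2 * i' = n - (2 * c' + 1) →
      ((Qset n (2 * c' + 1) c).card : ℝ) * ((c.factorial * (2 ^ i * i.factorial) * (2 ^ i' * i'.factorial) : ℕ) : ℝ) =
        Nt * (((2 * c' + 1).factorial * (n - (2 * c' + 1)).factorial : ℕ) : ℝ) := fun c i i' hci hci' => by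
    have e1 : ((Qset n (2 * c' + 1) c).card : ℝ) =
        ∑ U : OddSet n, ∑ M : PMatch n, (if U.1.card = 2 * c' + 1 ∧ cc U M = c then (1 : ℝ) else 0) := by
      rw [Qset, Finset.card_filter, Nat.cast_sum, Fintype.sum_prod_type]
      refine sum_congr rfl fun U _ => sum_congr rfl fun M _ => ?_
      split_ifs <;> simp
    have e2 : ∀ U : OddSet n, (∑ M : PMatch n, (if U.1.card = 2 * c' + 1 ∧ cc U M = c then (1 : ℝ) else 0)) *
        ((c.factorial * (2 ^ i * i.factorial) * (2 ^ i' * i'.factorial) : ℕ) : ℝ) =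
        (if U.1.card = 2 * c' + 1 then (1 : ℝ) else 0) * (((2 * c' + 1).factorial * (n - (2 * c' + 1)).factorial : ℕ) : ℝ) := by
      intro U
      by_cases hUt : U.1.card = 2 * c' + 1
      · rw [if_pos hUt, one_mul, ← htot U hUt c i i' hci hci']
        congr 1
        rw [sum_pmatch_level_eq' U hUt (fun _ => (1 : ℝ)) (c := c)]
        have hall : ∀ M' ∈ (perfectMatchings (univ : Finset (Fin n))).filter
            (fun M' => (M'.filter fun e => cutCount U.1 e = 1).card = c),
            (if h : IsPMOn (univ : Finset (Fin n)) M' then (1 : ℝ) else 0) = 1 := by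
          intro M' hM'
          rw [dif_pos (mem_perfectMatchings.1 (mem_filter.1 hM').1)]
        rw [sum_congr rfl hall, sum_const, nsmul_eq_mul, mul_one]
      · rw [if_neg hUt, zero_mul]
        have : ∀ M : PMatch n, (if U.1.card = 2 * c' + 1 ∧ cc U M = c then (1 : ℝ) else 0) = 0 :=
          fun M => if_neg fun h => hUt h.1
        rw [Fintype.sum_congr _ _ this]
        simp
    rw [e1, sum_mul, hNt, sum_mul]
    exact Fintype.sum_congr _ _ e2
  set Psharp : Polynomial ℝ := Polynomial.C (Nt⁻¹) * ∑ U : OddSet n, P U with hPsharp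
  have hPsharp_deg : Psharp.natDegree ≤ 2 * k := by
    refine (natDegree_C_mul_le _ _).trans ?_
    exact Polynomial.natDegree_sum_le_of_forall_le _ _ fun U _ => hPdeg U
  have hPsharp_eval : ∀ x : ℝ, Psharp.eval x = Nt⁻¹ * ∑ U : OddSet n, (P U).eval x := fun x => by
    rw [hPsharp, eval_mul, eval_C, eval_finsetSum]
  have hNtpos : 0 < Nt := by rw [hNt_eq]; exact hCn
  have hPsharp0 : 0 ≤ Psharp.eval 0 := by
    rw [hPsharp_eval]
    exact mul_nonneg (inv_nonneg.2 hNtpos.le) (sum_nonneg fun U _ => hP0 U)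
  set Φ : ℕ → ℝ := fun c => ∑ q ∈ Qset n (2 * c' + 1) c, (X q.1 * Y q.2).trace with hΦ
  have hΦlaw : ∀ mm : ℕ, mm ≤ c' →
      Φ (2 * mm + 1) = ((Qset n (2 * c' + 1) (2 * mm + 1)).card : ℝ) * Psharp.eval ((2 * mm + 1 : ℕ) : ℝ) ∧
      (0 : ℝ) < ((Qset n (2 * c' + 1) (2 * mm + 1)).card : ℝ) := fun mm hmm => by
    have hci : (2 * mm + 1) + 2 * (c' - mm) = 2 * c' + 1 := by omega
    obtain ⟨nn, hnn⟩ := hn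
    have hci' : (2 * mm + 1) + 2 * (nn - c' - mm - 1) = n - (2 * c' + 1) := by omega
    set Kc : ℝ := (((2 * mm + 1).factorial * (2 ^ (c' - mm) * (c' - mm).factorial) *
      (2 ^ (nn - c' - mm - 1) * (nn - c' - mm - 1).factorial) : ℕ) : ℝ) with hKc
    have hKpos : 0 < Kc := by rw [hKc]; positivity
    have hF0 : (0 : ℝ) < (((2 * c' + 1).factorial * (n - (2 * c' + 1)).factorial : ℕ) : ℝ) := by positivity
    have hQc := hQ (2 * mm + 1) (c' - mm) (nn - c' - mm - 1) hci hci'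
    have hQpos : (0 : ℝ) < ((Qset n (2 * c' + 1) (2 * mm + 1)).card : ℝ) := by
      have h1 : 0 < ((Qset n (2 * c' + 1) (2 * mm + 1)).card : ℝ) * Kc := by rw [hQc]; exact mul_pos hNtpos hF0
      exact (mul_pos_iff_of_pos_right hKpos).mp h1
    refine ⟨?_, hQpos⟩
    -- `Φ(c)·K_c = Σ_U (Σ_M ite)·K_c = t!(n−t)!·Σ_U P_U(c) = |Q_c|·K_c·Nt⁻¹·Σ_U P_U(c)`
    have hsum : Φ (2 * mm + 1) = ∑ U : OddSet n, ∑ M : PMatch n,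
        (if U.1.card = 2 * c' + 1 ∧ cc U M = 2 * mm + 1 then (X U * Y M).trace else 0) := by
      rw [hΦ]; simp only
      rw [← level_sum_eq_sum_Qset (2 * c' + 1) (2 * mm + 1) (fun U M => (X U * Y M).trace), sum_comm]
    have hU' : ∀ U : OddSet n, (∑ M : PMatch n, (if U.1.card = 2 * c' + 1 ∧ cc U M = 2 * mm + 1 then (X U * Y M).trace else 0)) * Kc =
        (((2 * c' + 1).factorial * (n - (2 * c' + 1)).factorial : ℕ) : ℝ) * (P U).eval (((2 * mm + 1 : ℕ) : ℝ)) := by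
      intro U
      by_cases hUt : U.1.card = 2 * c' + 1
      · rw [hPval U hUt (2 * mm + 1) (c' - mm) (nn - c' - mm - 1) hci hci', mul_right_comm, hKc,
          htot U hUt (2 * mm + 1) (c' - mm) (nn - c' - mm - 1) hci hci']
      · rw [hPzero U hUt]
        have : ∀ M : PMatch n, (if U.1.card = 2 * c' + 1 ∧ cc U M = 2 * mm + 1 then (X U * Y M).trace else 0) = 0 :=
          fun M => if_neg fun h => hUt h.1
        rw [Fintype.sum_congr _ _ this]
        simp
    have h1 : Φ (2 * mm + 1) * Kc = (((2 * c' + 1).factorial * (n - (2 * c' + 1)).factorial : ℕ) : ℝ) *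
        ∑ U : OddSet n, (P U).eval (((2 * mm + 1 : ℕ) : ℝ)) := by
      rw [hsum, sum_mul, mul_sum]
      exact Fintype.sum_congr _ _ hU'
    have h2 : ((Qset n (2 * c' + 1) (2 * mm + 1)).card : ℝ) * Psharp.eval ((2 * mm + 1 : ℕ) : ℝ) * Kc =
        (((2 * c' + 1).factorial * (n - (2 * c' + 1)).factorial : ℕ) : ℝ) * ∑ U : OddSet n, (P U).eval (((2 * mm + 1 : ℕ) : ℝ)) := by
      rw [hPsharp_eval, mul_right_comm, hQc]
      field_simp
    have h3 : Φ (2 * mm + 1) * Kc = ((Qset n (2 * c' + 1) (2 * mm + 1)).card : ℝ) * Psharp.eval ((2 * mm + 1 : ℕ) : ℝ) * Kc := by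
      rw [h1, h2]
    exact mul_right_cancel₀ hKpos.ne' h3
  obtain ⟨p, PK, hp, hpdec, hPKdeg, hPK0, hlevK⟩ :=
    tracial_profile_polynomial_of_contractions hn htn (show 2 * k ≤ 2 * c' by omega) X Y hX hY
  set τK : ℝ := (r : ℝ) * Real.sqrt (∏ i ∈ range (2 * k / 2 + 1), ((2 * i + 1 : ℝ) / ((n : ℝ) - 2 * i))) with hτK
  have hτK0 : 0 ≤ τK := mul_nonneg (Nat.cast_nonneg r) (Real.sqrt_nonneg _)
  have hcloseK : ∀ mm : ℕ, mm ≤ c' → |Psharp.eval ((2 * mm + 1 : ℕ) : ℝ) - PK.eval ((2 * mm + 1 : ℕ) : ℝ)| ≤ τK := fun mm hmm => by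
    have hci : (2 * mm + 1) + 2 * (c' - mm) = (2 * c' + 1) := by omega
    have hQpos : (0 : ℝ) < ((Qset n (2 * c' + 1) (2 * mm + 1)).card : ℝ) := (hΦlaw mm hmm).2
    have h1 := hlevK mm hmm
    have h2 : ∑ q ∈ Qset n (2 * c' + 1) (2 * mm + 1), (X q.1 * Y q.2).trace = Φ (2 * mm + 1) := rfl
    rw [h2, (hΦlaw mm hmm).1, ← mul_sub, abs_mul, Nat.abs_cast] at h1
    exact le_of_mul_le_mul_left h1 hQpos
  have hPK0_lb : -(2 ^ (2 * k + 1) * τK) ≤ PK.eval 0 := by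
    set Δ : Polynomial ℝ := Psharp - PK with hΔ
    have hΔdeg : Δ.natDegree ≤ 2 * k := (natDegree_sub_le _ _).trans (max_le hPsharp_deg hPKdeg)
    have hΔ0 : |Δ.eval 0| ≤ 2 ^ (2 * k + 1) * τK := by
      refine abs_eval_zero_le_two_pow_mul (2 * k) Δ hΔdeg hτK0 fun j hj => ?_
      have h := hcloseK j (by omega)
      rw [hΔ, eval_sub]
      push_cast at h ⊢
      exact h
    have h1 := (abs_le.1 hΔ0).2
    rw [hΔ, eval_sub] at h1
    linarith
  set k₁ : Finset (Fin n) → PMatch n → ℝ := fun U M => if (U.filter fun x => M.2.partner x ∉ U).card = 1 then (1 : ℝ) else 0 with hk₁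
  set Cm : ℕ → ℝ := fun κ => ∑ ab : Fin r × Fin r, ∑ M : PMatch n, Y M ab.2 ab.1 * ∑ U ∈ univ.powersetCard (2 * c' + 1),
    (up^[2 * c' + 1 - 2 * κ] (p ab (2 * κ))) U * k₁ U M with hCm
  set VK : ℝ := ∑ M : PMatch n, ∑ A' : {A' : Finset (Fin n) // A'.card ≤ 2 * k},
        (Matrix.of (fun a b : Fin r =>
          (∑ j ∈ range (2 * c' + 1 + 1), ((2 * c' + 1 - j).factorial : ℝ) • (if 2 * k < j then 0 else p (a, b) j)) A'.1) * Y M).trace *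
          knapsackMoment M.1.card (((2 * c' + 1 : ℕ) : ℝ) / 2) (M.1.filter fun e => ∃ a ∈ A'.1, a ∈ e).card with hVK
  set VD : ℝ := ∑ M : PMatch n, ∑ A' : {A' : Finset (Fin n) // A'.card ≤ D},
        (Matrix.of (fun a b : Fin r =>
          (∑ j ∈ range (2 * c' + 1 + 1), ((2 * c' + 1 - j).factorial : ℝ) • (if D < j then 0 else p (a, b) j)) A'.1) * Y M).trace *
          knapsackMoment M.1.card (((2 * c' + 1 : ℕ) : ℝ) / 2) (M.1.filter fun e => ∃ a ∈ A'.1, a ∈ e).card with hVD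
  have h45K : VK * N₁ = ∑ κ ∈ range (2 * k / 2 + 1), R κ * Cm κ := virtual_psd_mul_eq hn ht (show 2 * k ≤ 2 * c' by omega) p hp Y
  have h45D : VD * N₁ = ∑ κ ∈ range (D / 2 + 1), R κ * Cm κ := virtual_psd_mul_eq hn ht hD p hp Y
  have hk2 : 2 * k / 2 = k := by omega
  rw [hk2] at h45K hτK
  -- `VK = Pm · PK(0)`
  have hVK_eq : VK = Pm * PK.eval 0 := by
    rw [hPK0, ← mul_assoc, mul_inv_cancel₀ hPm.ne', one_mul]
  obtain ⟨κ₁, hA1⟩ := exists_tightGram_classFunction (n := n) (odd_two_mul_add_one c')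
  have hXtr := sum_trace_cuts_le (c' := c') hX
  have hYtr := sum_trace_matchings_le hY
  have hmode : ∀ κ, κ ≤ c' → |Cm κ| ≤ (r : ℝ) * Pm * N₁ * Real.sqrt (Aκ κ) := fun κ hκ => by
    have hsq := HSmode_sq_le_traces hn ht hκ X Y hX hY p hp hpdec κ₁ hA1
    have hbound : (∑ M : PMatch n, (Y M).trace) * (∑ U ∈ univ.filter (fun U : OddSet n => U.1.card = 2 * c' + 1), (X U).trace) *
        (Pm * N₁ ^ 2 / Cn * Aκ κ) ≤ ((r : ℝ) * Pm * N₁ * Real.sqrt (Aκ κ)) ^ 2 := by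
      have hYtr0 : 0 ≤ ∑ M : PMatch n, (Y M).trace := sum_nonneg fun M _ => (hY M).1.trace_nonneg
      have hXtr0 : 0 ≤ ∑ U ∈ univ.filter (fun U : OddSet n => U.1.card = 2 * c' + 1), (X U).trace :=
        sum_nonneg fun U _ => (hX U).1.trace_nonneg
      have hc0 : 0 ≤ Pm * N₁ ^ 2 / Cn * Aκ κ := mul_nonneg (div_nonneg (mul_nonneg hPm.le (sq_nonneg _)) hCn.le) (hAκ0 κ hκ)
      calc (∑ M : PMatch n, (Y M).trace) * (∑ U ∈ univ.filter (fun U : OddSet n => U.1.card = 2 * c' + 1), (X U).trace) *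
            (Pm * N₁ ^ 2 / Cn * Aκ κ)
          ≤ ((r : ℝ) * Pm) * ((r : ℝ) * Cn) * (Pm * N₁ ^ 2 / Cn * Aκ κ) := by
            exact mul_le_mul_of_nonneg_right (mul_le_mul hYtr hXtr hXtr0 (mul_nonneg (Nat.cast_nonneg r) hPm.le)) hc0
        _ = (r : ℝ) ^ 2 * Pm ^ 2 * N₁ ^ 2 * Aκ κ * (Cn * Cn⁻¹) := by ring
        _ = (r : ℝ) ^ 2 * Pm ^ 2 * N₁ ^ 2 * Aκ κ := by rw [mul_inv_cancel₀ hCn.ne', mul_one]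
        _ = ((r : ℝ) * Pm * N₁ * Real.sqrt (Aκ κ)) ^ 2 := by
            rw [show ((r : ℝ) * Pm * N₁ * Real.sqrt (Aκ κ)) ^ 2 = (r : ℝ) ^ 2 * Pm ^ 2 * N₁ ^ 2 * (Real.sqrt (Aκ κ)) ^ 2 by ring,
              Real.sq_sqrt (hAκ0 κ hκ)]
    have h2 : (Cm κ) ^ 2 ≤ ((r : ℝ) * Pm * N₁ * Real.sqrt (Aκ κ)) ^ 2 := hsq.trans hbound
    have h3 : 0 ≤ (r : ℝ) * Pm * N₁ * Real.sqrt (Aκ κ) :=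
      mul_nonneg (mul_nonneg (mul_nonneg (Nat.cast_nonneg r) hPm.le) hN₁pos.le) (Real.sqrt_nonneg _)
    exact abs_le.2 (abs_le_of_sq_le_sq' h2 h3)
  have hmid : |∑ κ ∈ Ico (D / 2 + 1) (k + 1), R κ * Cm κ| ≤
      (r : ℝ) * Pm * N₁ * ∑ κ ∈ Ico (D / 2 + 1) (k + 1), R κ * Real.sqrt (Aκ κ) := by
    calc |∑ κ ∈ Ico (D / 2 + 1) (k + 1), R κ * Cm κ| ≤ ∑ κ ∈ Ico (D / 2 + 1) (k + 1), |R κ * Cm κ| := abs_sum_le_sum_abs _ _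
      _ ≤ ∑ κ ∈ Ico (D / 2 + 1) (k + 1), R κ * ((r : ℝ) * Pm * N₁ * Real.sqrt (Aκ κ)) := by
          refine sum_le_sum fun κ hκ => ?_
          have hκc : κ ≤ c' := by have := (mem_Ico.1 hκ).2; omega
          rw [abs_mul, abs_of_nonneg (layerRatio_nonneg ht hκc)]
          exact mul_le_mul_of_nonneg_left (hmode κ hκc) (layerRatio_nonneg ht hκc)
      _ = (r : ℝ) * Pm * N₁ * ∑ κ ∈ Ico (D / 2 + 1) (k + 1), R κ * Real.sqrt (Aκ κ) := by
          rw [mul_sum]; exact sum_congr rfl fun κ _ => by ring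
  -- `VD·N₁ = VK·N₁ − (middle modes)`
  have hsplit : VD * N₁ = VK * N₁ - ∑ κ ∈ Ico (D / 2 + 1) (k + 1), R κ * Cm κ := by
    rw [h45D, h45K, ← sum_range_add_sum_Ico _ (show D / 2 + 1 ≤ k + 1 by omega)]
    ring
  have hVD_lb : -(2 ^ (2 * k + 1) * τK) - (r : ℝ) * ∑ κ ∈ Ico (D / 2 + 1) (k + 1), R κ * Real.sqrt (Aκ κ) ≤ Pm⁻¹ * VD := by
    have h1 : Pm * N₁ * (-(2 ^ (2 * k + 1) * τK)) ≤ VK * N₁ := by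
      rw [hVK_eq]
      have := mul_le_mul_of_nonneg_left hPK0_lb (mul_pos hPm hN₁pos).le
      linarith [this]
    have h2 := (abs_le.1 hmid).2
    have h3 : Pm * N₁ * (-(2 ^ (2 * k + 1) * τK) - (r : ℝ) * ∑ κ ∈ Ico (D / 2 + 1) (k + 1), R κ * Real.sqrt (Aκ κ)) ≤ VD * N₁ := by
      rw [hsplit]; nlinarith [h1, h2]
    have h4 : (-(2 ^ (2 * k + 1) * τK) - (r : ℝ) * ∑ κ ∈ Ico (D / 2 + 1) (k + 1), R κ * Real.sqrt (Aκ κ)) * (Pm * N₁) ≤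
        (Pm⁻¹ * VD) * (Pm * N₁) := by
      calc _ = Pm * N₁ * (-(2 ^ (2 * k + 1) * τK) - (r : ℝ) * ∑ κ ∈ Ico (D / 2 + 1) (k + 1), R κ * Real.sqrt (Aκ κ)) := by ring
        _ ≤ VD * N₁ := h3
        _ = (Pm⁻¹ * VD) * (Pm * N₁) := by field_simp
    exact le_of_mul_le_mul_right h4 (mul_pos hPm hN₁pos)
  have htrunc := tracial_value_truncation_of_data hn hdes' hD X Y p hp hpdec
  have hPD := Summit.PneNP.PneNP.Theorems.ChebyshevTracialDesignProfilePolynomial.prod_atten_nonneg (n := n) (K := D) (by omega)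
  have htail := sqrt_tail_le_of_le hPD hCn hPm (Nat.cast_nonneg r)
    (sum_nonneg fun M _ => by positivity) (sum_frobenius_cuts_le ⟨c', rfl⟩ hX) (sum_frobenius_matchings_le hY)
  have hBv0 : 0 ≤ ∑ c ∈ C, |w c| := sum_nonneg fun c _ => abs_nonneg _
  have hval_le : ∑ U, ∑ M, levelWeight n (2 * c' + 1) C w U M * (X U * Y M).trace ≤
      -(Pm⁻¹ * VD) + Bv * ((r : ℝ) * Real.sqrt (∏ i ∈ range (D / 2 + 1), ((2 * i + 1 : ℝ) / ((n : ℝ) - 2 * i)))) := by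
    have h1 := (abs_le.1 htrunc).2
    have h2 : (∑ c ∈ C, |w c|) * Real.sqrt ((∏ i ∈ range (D / 2 + 1), ((2 * i + 1 : ℝ) / ((n : ℝ) - 2 * i))) *
        ((∑ U : OddSet n, if U.1.card = 2 * c' + 1 then ∑ a, ∑ b, X U a b ^ 2 else 0) / (n.choose (2 * c' + 1) : ℝ)) *
        ((∑ M : PMatch n, ∑ a, ∑ b, Y M a b ^ 2) / (Fintype.card (PMatch n) : ℝ))) ≤
        Bv * ((r : ℝ) * Real.sqrt (∏ i ∈ range (D / 2 + 1), ((2 * i + 1 : ℝ) / ((n : ℝ) - 2 * i)))) :=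
      (mul_le_mul_of_nonneg_left htail hBv0).trans (mul_le_mul_of_nonneg_right hBv (mul_nonneg (Nat.cast_nonneg r) (Real.sqrt_nonneg _)))
    linarith
  have hsum0 : 0 ≤ ∑ κ ∈ Ico (D / 2 + 1) (k + 1), R κ * Real.sqrt (Aκ κ) :=
    sum_nonneg fun κ hκ => mul_nonneg (layerRatio_nonneg ht (by have := (mem_Ico.1 hκ).2; omega)) (Real.sqrt_nonneg _)
  have hfinal : ∑ U, ∑ M, levelWeight n (2 * c' + 1) C w U M * (X U * Y M).trace ≤
      (r : ℝ) * (Bv * Real.sqrt (∏ i ∈ range (D / 2 + 1), ((2 * i + 1 : ℝ) / ((n : ℝ) - 2 * i))) +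
        2 ^ (2 * k + 1) * Real.sqrt (∏ i ∈ range (k + 1), ((2 * i + 1 : ℝ) / ((n : ℝ) - 2 * i))) +
        ∑ κ ∈ Ico (D / 2 + 1) (k + 1), R κ * Real.sqrt (Aκ κ)) := by
    have e : (r : ℝ) * (Bv * Real.sqrt (∏ i ∈ range (D / 2 + 1), ((2 * i + 1 : ℝ) / ((n : ℝ) - 2 * i))) +
        2 ^ (2 * k + 1) * Real.sqrt (∏ i ∈ range (k + 1), ((2 * i + 1 : ℝ) / ((n : ℝ) - 2 * i))) +
        ∑ κ ∈ Ico (D / 2 + 1) (k + 1), R κ * Real.sqrt (Aκ κ)) =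
        Bv * ((r : ℝ) * Real.sqrt (∏ i ∈ range (D / 2 + 1), ((2 * i + 1 : ℝ) / ((n : ℝ) - 2 * i)))) +
        2 ^ (2 * k + 1) * τK + (r : ℝ) * ∑ κ ∈ Ico (D / 2 + 1) (k + 1), R κ * Real.sqrt (Aκ κ) := by
      rw [hτK]; ring
    rw [e]
    linarith [hval_le, hVD_lb]
  simpa only [hYdef] using hfinal

/-! ### §2 Unconditional: the clique forms are positive for `6k'+1 ≤ t`, `6k'+1 ≤ n − t` -/

/-- **THE MATCHING-SIDE SIGN CELL AT ALL MATCHING DEGREES `k' ≤ c'/2`, UNCONDITIONAL** (`6k'+1 ≤ t`, `6k'+1 ≤ n − t`): see the file header.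
[cite: Potechin2019, Thm. 1.2 and Cor. 3.10 (LIPIcs 124, 61:4, 61:9)] [cite: Rothvoss2017, §2 (PDF p. 6)] [cite: GriblingDelaatLaurent2019, §5] -/
theorem value_le_of_lowDegreeM_allModes {c' T D : ℕ} {Bv : ℝ} {C : Finset ℕ} {w : ℕ → ℝ} (hn : Even n)
    (hdes : IsExactDesign n (2 * c' + 1) T D Bv C w) (hD : D ≤ 2 * c') {r m k : ℕ} (hDk : D ≤ 2 * k) (hkc : 2 * k ≤ c')
    (hkt : 6 * k + 1 ≤ 2 * c' + 1) (hknt : 6 * k + 1 ≤ n - (2 * c' + 1))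
    (X : OddSet n → Matrix (Fin r) (Fin r) ℝ) (hX : ∀ U, (X U).PosSemidef ∧ (1 - X U).PosSemidef)
    (B : PMatch n → Matrix (Fin r) (Fin m) ℝ) (hB : IsLowDegreeM n k B) (hB1 : ∀ M, (1 - B M * (B M)ᵀ).PosSemidef) :
    ∑ U, ∑ M, levelWeight n (2 * c' + 1) C w U M * (X U * (B M * (B M)ᵀ)).trace ≤
      (r : ℝ) * (Bv * Real.sqrt (∏ i ∈ range (D / 2 + 1), ((2 * i + 1 : ℝ) / ((n : ℝ) - 2 * i))) +
        2 ^ (2 * k + 1) * Real.sqrt (∏ i ∈ range (k + 1), ((2 * i + 1 : ℝ) / ((n : ℝ) - 2 * i))) +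
        ∑ κ ∈ Ico (D / 2 + 1) (k + 1),
          (∏ i ∈ range κ, (((2 * c' + 1 : ℝ) - 2 * i) * ((n : ℝ) - 2 * c' - 1 - 2 * i) /
              (((2 * c' : ℝ) - 2 * i) * ((n : ℝ) - 2 * c' - 2 - 2 * i)))) *
            Real.sqrt (∏ i ∈ range κ, ((2 * i + 1 : ℝ) / ((n : ℝ) - 2 * i)))) := by
  classical
  set ν : Finset (Fin n) → Finset (Sym2 (Fin n)) → ℝ := fun W G =>
    if ((univ : Finset (PMatch n)).filter fun M => G ⊆ M.1).Nonempty ∧ (∀ e ∈ G, ∀ x ∈ e, x ∈ W) then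
      (∏ j ∈ range G.card, ((W.card : ℝ) - 1 - 2 * j))⁻¹ else 0 with hνdef
  have hν : ∀ W G, ν W G = if ((univ : Finset (PMatch n)).filter fun M => G ⊆ M.1).Nonempty ∧ (∀ e ∈ G, ∀ x ∈ e, x ∈ W) then
      (∏ j ∈ range G.card, ((W.card : ℝ) - 1 - 2 * j))⁻¹ else 0 := fun W G => rfl
  have hstory := story_nonneg_of_six_mul_le (m := 6 * k + 1) (k := k) ⟨3 * k, by ring⟩ (by omega)
  have hall := form_nonneg_of_base ν hν (show 4 * k + 1 ≤ 6 * k + 1 by omega)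
    (fun W hW δ => base_nonneg_of_story_nonneg ν hν hstory W hW δ)
  refine value_le_of_lowDegreeM_allModes_of_forms hn hdes hD hDk hkc X hX B hB hB1 (fun U hUt δ => ?_) (fun U hUt δ => ?_)
  · -- the clique `U`: size `t = (6k+1) + 2i`
    obtain ⟨i, hi⟩ : ∃ i, 2 * c' + 1 = 6 * k + 1 + 2 * i := ⟨c' - 3 * k, by omega⟩
    have h := hall i U.1 (by rw [hUt, hi]) δ
    refine le_of_le_of_eq h (sum_congr rfl fun A _ => sum_congr rfl fun A' _ => ?_)
    rw [hν, hUt]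
    simp only [cutCount_eq_two_iff]
  · -- the clique `Ū`: size `n − t = (6k+1) + 2i'`
    obtain ⟨i', hi'⟩ : ∃ i', n - (2 * c' + 1) = 6 * k + 1 + 2 * i' := by
      obtain ⟨b, hb⟩ := hn; exact ⟨b - c' - 3 * k - 1, by omega⟩
    have hcard : ((univ : Finset (Fin n)) \ U.1).card = n - (2 * c' + 1) := by
      rw [card_sdiff_of_subset (subset_univ _), card_univ, Fintype.card_fin, hUt]
    have h := hall i' ((univ : Finset (Fin n)) \ U.1) (by rw [hcard, hi']) δ
    refine le_of_le_of_eq h (sum_congr rfl fun A _ => sum_congr rfl fun A' _ => ?_)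
    rw [hν, hcard]
    simp only [cutCount_eq_zero_iff]

end Summit.PneNP.PneNP.Theorems.ChebyshevTracialDesignExtendedSignMatchingSide
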